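import Mathlib.LinearAlgebra.Matrix.Determinant.Basic
import Mathlib.LinearAlgebra.Matrix.Block
import Mathlib.Data.Finset.Sort
import Mathlib.Order.WellFounded
import Mathlib.Algebra.Polynomial.Coeff
import Mathlib.Algebra.Polynomial.Div
import Mathlib.Algebra.Polynomial.FieldDivision
import Mathlib.RingTheory.Polynomial.Chebyshev
import Mathlib.Analysis.SpecialFunctions.Trigonometric.Chebyshev.Basic
import Mathlib.Analysis.SpecialFunctions.Complex.Arg
import Mathlib.Analysis.Complex.Polynomial.Basic
import Literature.Analysis.TotalPositivity.PolyaFrequency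
import Literature.Analysis.TotalPositivity.PolyaFrequencyClosure
import Literature.Analysis.TotalPositivity.MultiplyPositive
import HarnessLib

/-!
# Schoenberg's sector theorem (`PF_m` polynomials) — proofs

Trunk T-ANALYSIS (Literature/Analysis/TotalPositivity). Discharges the named fact
`Literature.Analysis.TotalPositivity.schoenberg_sector_pf` of `MultiplyPositive.lean` — **Katkova 2006, §1,
Thm. B** (= Schoenberg 1955): a real polynomial `f` with `f(0) > 0` and no zeros in the open
sector `|arg z| < πm/(m+1)` has an `m`-times positive coefficient sequence — as
`Literature.Analysis.TotalPositivity.schoenberg_sector_pf_holds`. This is leaf L1 of the decomposition of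
`Literature.NumberTheory.LFunctions.katkova_pf44` (Katkova's Thm. 1, `ξ₁ ∈ PF₄₄`).

## Proof (the classical one, [Schoenberg 1955] as summarised in [Katkova 2006, §1])

1. **Cauchy–Binet** (`det_mul_eq_sum_strictMono`): `det (A B) = Σ_t det A[·,t] det B[t,·]` over
   increasing `t`; hence the Toeplitz minors of a Cauchy product `a ⋆ b` are sums of products of
   minors of `a` and `b` of the same order (`toeplitzMinor_conv`), and **`PF_m` is closed under
   convolution** (`IsMultiplyPositiveSeq.conv`, `.mul_poly`). Mathlib (this tree) has `det_mul`
   only for square matrices; the rectangular formula is proved here from `det_apply'`.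
2. **Three-term sequences** (`isMultiplyPositiveSeq_of_continuant_nonneg`): for
   `a = (a₀, a₁, a₂, 0, …)` every Toeplitz minor either splits at a vanishing off-diagonal block
   into two smaller minors (`toeplitzMinor_split_of_upperRight/lowerLeft`), or is *rigid*
   (consecutive rows and columns, `rᵢ = cᵢ + 1`) and equals the continuant
   `Dₙ = det (a_{i+1-j})_{i,j<n}` (`det_triToeplitz`, `D_{n+2} = a₁D_{n+1} - a₀a₂Dₙ`). So
   `a₀, a₁, a₂ ≥ 0` and `Dₙ ≥ 0 (n ≤ m)` give `PF_m`.
3. **The factors**: `X + t` (`t ≥ 0`) has `Dₙ = 1`; `X² + 2ρ cos φ X + ρ²` has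
   `Dₙ = ρⁿ Uₙ(cos φ) = ρⁿ sin((n+1)φ)/sin φ` (Chebyshev `U`, Mathlib's
   `Polynomial.Chebyshev.U_real_cos`), which is `≥ 0` for `n ≤ m` iff `(m+1)φ ≤ π`
   (`isMultiplyPositiveSeq_coeff_quadratic`) — Schoenberg's "`(1, 2cos φ, 1) ∈ PF_m ⟺
   φ ≤ π/(m+1)`".
4. **Induction on the degree** (`schoenberg_sector_pf_aux`): a complex root `w` of `f` is either
   real — then negative, since `f(0) > 0` and the positive axis lies in the sector — giving a
   factor `X + t`, or non-real with `|arg w| ≥ πm/(m+1)`, giving (Mathlib's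
   `Polynomial.quadratic_dvd_of_aeval_eq_zero_im_ne_zero`) the factor
   `X² - 2 Re w X + |w|² = X² + 2|w| cos φ X + |w|²`, `φ = π - |arg w| ∈ (0, π/(m+1)]`.

## Main statements

* `det_mul_eq_sum_strictMono` — Cauchy–Binet; `IsMultiplyPositiveSeq.conv` — `PF_m ⋆ PF_m ⊆ PF_m`.
* `isMultiplyPositiveSeq_of_continuant_nonneg` — Schoenberg's three-term lemma.
* `schoenberg_sector_pf_holds : schoenberg_sector_pf`.

## References

* I. J. Schoenberg, *A note on multiply positive sequences and the Descartes rule of signs*,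
  Rend. Circ. Mat. Palermo (2) 4 (1955) 123–131. [Schoenberg1955]
* O. M. Katkova, *Multiple positivity and the Riemann zeta-function*, CMFT 7 (2007) 13–31;
  arXiv:math/0505174, §1, Thm. B. [Katkova2006]
* S. Karlin, *Total Positivity I*, Stanford UP 1968, Ch. 0 §1 (Cauchy–Binet), Ch. 8 §1.
  [Karlin1968]
* F. R. Gantmacher, *The Theory of Matrices* I, Chelsea 1959, Ch. I §2 (Binet–Cauchy formula).
-/

noncomputable section

namespace Literature.Analysis.TotalPositivity

open Finset Equiv Matrix Polynomial

section CauchyBinet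

variable {R : Type*} [CommRing R]

/-! ### The Cauchy–Binet formula -/

/-- Expansion of `det (A * B)` over all maps `p : Fin k → ι` (columns of `A` / rows of `B`
selected with repetition). [folklore] -/
theorem det_mul_eq_sum_pi {k : ℕ} {ι : Type*} [Fintype ι] [DecidableEq ι]
    (A : Matrix (Fin k) ι R) (B : Matrix ι (Fin k) R) :
    (A * B).det = ∑ p : Fin k → ι, (∏ i, B (p i) i) * (A.submatrix id p).det := by
  simp only [det_apply', mul_apply, prod_univ_sum, mul_sum, Fintype.piFinset_univ]
  rw [Finset.sum_comm]
  refine Finset.sum_congr rfl fun p _ => ?_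
  refine Finset.sum_congr rfl fun σ _ => ?_
  simp only [submatrix_apply, id, prod_mul_distrib]
  ring

/-- Terms with a non-injective selection vanish (two equal columns). [folklore] -/
theorem det_submatrix_eq_zero_of_not_injective {k : ℕ} {ι : Type*}
    (A : Matrix (Fin k) ι R) {p : Fin k → ι} (hp : ¬ Function.Injective p) :
    (A.submatrix id p).det = 0 := by
  unfold Function.Injective at hp
  push Not at hp
  obtain ⟨i, j, hij, hne⟩ := hp
  exact det_zero_of_column_eq hne fun l => by simp [hij]

open scoped Classical in
/-- **Cauchy–Binet formula.** For `A : k × ι` and `B : ι × k` (`ι` a finite linear order),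
`det (A B) = Σ_t det A[·, t] · det B[t, ·]`, the sum over strictly increasing `t : Fin k → ι`
(i.e. over the `k`-element subsets of `ι`). Proof: expand over all selections `p`, drop the
non-injective ones, and write each injective `p` uniquely as `t ∘ τ` (`t` increasing, `τ` a
permutation). [Gantmacher 1959, Ch. I §2 (14); Karlin 1968, Ch. 0 §1] [folklore] -/
theorem det_mul_eq_sum_strictMono {k : ℕ} {ι : Type*} [Fintype ι] [LinearOrder ι]
    (A : Matrix (Fin k) ι R) (B : Matrix ι (Fin k) R) :
    (A * B).det = ∑ t ∈ (univ : Finset (Fin k → ι)).filter (fun t => StrictMono t),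
      (A.submatrix id t).det * (B.submatrix t id).det := by
  rw [det_mul_eq_sum_pi]
  -- only injective selections contribute
  set G : (Fin k → ι) → R := fun p => (∏ i, B (p i) i) * (A.submatrix id p).det with hG
  have hL : ∑ p : Fin k → ι, G p = ∑ p ∈ univ.filter (fun p : Fin k → ι => Function.Injective p),
      G p := by
    refine (Finset.sum_subset (filter_subset _ _) fun p _ hp => ?_).symm
    rw [mem_filter, not_and] at hp
    simp only [hG, det_submatrix_eq_zero_of_not_injective A (hp (mem_univ p)), mul_zero]
  rw [hL]
  -- expand `det B[t, ·]` and recognise `G (t ∘ τ)`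
  have hR : ∀ t : Fin k → ι, (A.submatrix id t).det * (B.submatrix t id).det =
      ∑ τ : Perm (Fin k), G (t ∘ τ) := by
    intro t
    rw [det_apply' (B.submatrix t id), Finset.mul_sum]
    refine Finset.sum_congr rfl fun τ _ => ?_
    simp only [hG]
    have : A.submatrix id (t ∘ ⇑τ) = (A.submatrix id t).submatrix id τ := rfl
    rw [this, det_permute']
    simp only [submatrix_apply, id, Function.comp]
    ring
  simp_rw [hR]
  rw [← Finset.sum_product']
  symm
  -- the bijection `(t, τ) ↦ t ∘ τ` onto injective maps
  refine Finset.sum_bij (fun x _ => x.1 ∘ ⇑x.2) ?_ ?_ ?_ ?_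
  · rintro ⟨t, τ⟩ hx
    simp only [mem_product, mem_filter, mem_univ, true_and, and_true] at hx
    simp only [mem_filter, mem_univ, true_and]
    exact hx.injective.comp τ.injective
  · rintro ⟨t, τ⟩ hx ⟨t', τ'⟩ hx' h
    simp only [mem_product, mem_filter, mem_univ, true_and, and_true] at hx hx'
    simp only at h
    have hrange : Set.range t = Set.range t' := by
      rw [← τ.surjective.range_comp t, ← τ'.surjective.range_comp t']
      exact congrArg Set.range h
    obtain rfl : t = t' := (hx.range_inj hx').1 hrange
    have hτ : (⇑τ : Fin k → Fin k) = ⇑τ' := (hx.injective.comp_left) h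
    simp only [Prod.mk.injEq, true_and]
    exact Equiv.ext fun i => congrFun hτ i
  · intro p hp
    simp only [mem_filter, mem_univ, true_and] at hp
    set s : Finset ι := univ.image p with hs
    have hcard : s.card = k := by
      rw [hs, card_image_of_injective _ hp, card_univ, Fintype.card_fin]
    set e := s.orderIsoOfFin hcard with he
    set g : Fin k → Fin k := fun i => e.symm ⟨p i, mem_image_of_mem p (mem_univ i)⟩ with hg
    have htg : ∀ i, (s.orderEmbOfFin hcard) (g i) = p i := by
      intro i
      rw [← Finset.coe_orderIsoOfFin_apply, ← he, OrderIso.apply_symm_apply]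
    have hginj : Function.Injective g := by
      intro i j hij
      have := congrArg (fun x => (s.orderEmbOfFin hcard) x) hij
      simp only [htg] at this
      exact hp this
    refine ⟨(⇑(s.orderEmbOfFin hcard), Equiv.ofBijective g hginj.bijective_of_finite), ?_, ?_⟩
    · simp only [mem_product, mem_filter, mem_univ, true_and, and_true]
      exact (s.orderEmbOfFin hcard).strictMono
    · funext i
      simp [htg]
  · intro x _
    rfl

end CauchyBinet

/-! ### Convolution of one-sided sequences and `PF_m` -/

/-- The Cauchy product `(a ⋆ b)_n = Σ_{u+v=n} a_u b_v` of two one-sided sequences — the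
coefficient sequence of the product of the generating functions. [Karlin 1968, Ch. 8 §1]
[folklore] -/
def conv (a b : ℕ → ℝ) (n : ℕ) : ℝ :=
  ∑ x ∈ Finset.antidiagonal n, a x.1 * b x.2

/-- Coefficients of a product of polynomials are the convolution of the coefficients.
[folklore] -/
theorem coeff_mul_eq_conv (p q : ℝ[X]) :
    (fun n => (p * q).coeff n) = conv (fun n => p.coeff n) (fun n => q.coeff n) := by
  funext n
  rw [Polynomial.coeff_mul]
  rfl

/-- The Toeplitz matrix of `a ⋆ b` is the product of the (lower-triangular) Toeplitz matrices
of `a` and `b`; entrywise, with the inner index truncated at any `N > i` and an unrestricted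
column index `j` (the `k × N` form that `toeplitzMinor_conv` needs). The square `N × N` case is
"Toeplitz matrices multiply like power series", `Literature.Analysis.TotalPositivity.psToeplitz_mul` in
`PolyaFrequencyDeflation.lean` (`conv a b n = PowerSeries.coeff n (mk a * mk b)`); the two APIs
could be merged by a librarian. [Karlin 1968, Ch. 8 §1] [folklore] -/
theorem seqZ_conv (a b : ℕ → ℝ) {N i j : ℕ} (hi : i < N) :
    seqZ (conv a b) ((i : ℤ) - j) =
      ∑ l : Fin N, seqZ a ((i : ℤ) - (l : ℕ)) * seqZ b (((l : ℕ) : ℤ) - j) := by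
  rw [Fin.sum_univ_eq_sum_range (fun l => seqZ a ((i : ℤ) - (l : ℕ)) * seqZ b (((l : ℕ) : ℤ) - j)) N]
  by_cases hji : j ≤ i
  · have hsub : Finset.Ico j (i + 1) ⊆ Finset.range N := fun l hl => by
      simp only [Finset.mem_Ico] at hl
      simp only [Finset.mem_range]
      omega
    rw [← Finset.sum_subset hsub (fun l hl hl' => ?_)]
    · rw [Finset.sum_Ico_eq_sum_range]
      obtain ⟨n, rfl⟩ := Nat.exists_eq_add_of_le hji
      have h1 : ((j + n : ℕ) : ℤ) - j = (n : ℕ) := by push_cast; ring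
      rw [h1, seqZ_natCast, conv, Finset.Nat.sum_antidiagonal_eq_sum_range_succ (fun u v => a u * b v),
        show j + n + 1 - j = n + 1 by omega, ← Finset.sum_range_reflect _ (n + 1)]
      refine Finset.sum_congr rfl fun v hv => ?_
      rw [Finset.mem_range] at hv
      have hv' : v ≤ n := by omega
      have h2 : ((j + n : ℕ) : ℤ) - ((j + v : ℕ) : ℤ) = ((n - v : ℕ) : ℤ) := by
        push_cast [Nat.cast_sub hv']; ring
      have h3 : ((j + v : ℕ) : ℤ) - j = (v : ℕ) := by push_cast; ring
      rw [h2, h3, seqZ_natCast, seqZ_natCast, show n + 1 - 1 - v = n - v by omega,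
        Nat.sub_sub_self hv']
    · -- outside `[j, i]` one factor vanishes
      rw [Finset.mem_Ico, not_and_or, not_le, not_lt] at hl'
      rcases hl' with h | h
      · rw [seqZ_of_neg b (by omega), mul_zero]
      · rw [seqZ_of_neg a (by omega), zero_mul]
  · rw [seqZ_of_neg _ (by omega)]
    symm
    refine Finset.sum_eq_zero fun l _ => ?_
    by_cases h : i < l
    · rw [seqZ_of_neg a (by omega), zero_mul]
    · rw [seqZ_of_neg b (by omega), mul_zero]

open scoped Classical in
/-- **Cauchy–Binet for Toeplitz minors**: a minor of the Toeplitz matrix of `a ⋆ b` is the sum,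
over intermediate index sets `t`, of the products of the corresponding minors of `a` and of `b`.
[Karlin 1968, Ch. 8 §1 (composition formula); Schoenberg 1955] [folklore] -/
theorem toeplitzMinor_conv (a b : ℕ → ℝ) {k : ℕ} (r c : Fin k → ℕ) {N : ℕ} (hN : ∀ i, r i < N) :
    toeplitzMinor (conv a b) r c =
      ∑ t ∈ (univ : Finset (Fin k → Fin N)).filter (fun t => StrictMono t),
        toeplitzMinor a r (fun i => (t i : ℕ)) * toeplitzMinor b (fun i => (t i : ℕ)) c := by
  have hmat : (Matrix.of fun i j : Fin k => seqZ (conv a b) ((r i : ℤ) - c j)) =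
      (Matrix.of fun (i : Fin k) (l : Fin N) => seqZ a ((r i : ℤ) - (l : ℕ))) *
        Matrix.of fun (l : Fin N) (j : Fin k) => seqZ b (((l : ℕ) : ℤ) - c j) := by
    ext i j
    rw [Matrix.mul_apply, Matrix.of_apply]
    simp only [Matrix.of_apply]
    exact seqZ_conv a b (hN i)
  unfold toeplitzMinor
  rw [hmat, det_mul_eq_sum_strictMono]
  rfl

/-- **`PF_m` is closed under convolution** (Schoenberg; immediate from Cauchy–Binet: every minor
of order `k ≤ m` of `a ⋆ b` is a sum of products of order-`k` minors of `a` and `b`).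
[Katkova 2006, §1 (proof of Thm. B via [Schoenberg 1955]); Karlin 1968, Ch. 8 §1] [folklore] -/
theorem IsMultiplyPositiveSeq.conv {m : ℕ} {a b : ℕ → ℝ} (ha : IsMultiplyPositiveSeq m a)
    (hb : IsMultiplyPositiveSeq m b) : IsMultiplyPositiveSeq m (conv a b) := by
  classical
  intro k hk r c hr hc
  have hN : ∀ i, r i < univ.sup r + 1 := fun i => Nat.lt_succ_of_le (Finset.le_sup (mem_univ i))
  rw [toeplitzMinor_conv a b r c hN]
  refine Finset.sum_nonneg fun t ht => ?_
  simp only [mem_filter, mem_univ, true_and] at ht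
  have ht' : StrictMono fun i => (t i : ℕ) := Fin.val_strictMono.comp ht
  exact mul_nonneg (ha k hk _ _ hr ht') (hb k hk _ _ ht' hc)

/-- `PF_m` is closed under products of generating polynomials. [Katkova 2006, §1 Thm. B (proof)]
[folklore] -/
theorem IsMultiplyPositiveSeq.mul_poly {m : ℕ} {p q : ℝ[X]}
    (hp : IsMultiplyPositiveSeq m fun n => p.coeff n) (hq : IsMultiplyPositiveSeq m fun n => q.coeff n) :
    IsMultiplyPositiveSeq m fun n => (p * q).coeff n := by
  rw [coeff_mul_eq_conv]
  exact hp.conv hq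


/-! ### Block splitting of Toeplitz minors -/

section Blocks

variable {R : Type*} [CommRing R]

/-- A square matrix over `Fin (s + t)` whose upper-right `s × t` block vanishes has determinant
`det (upper-left) · det (lower-right)`. [folklore] -/
theorem det_eq_mul_of_upperRight_eq_zero {s t : ℕ} (M : Matrix (Fin (s + t)) (Fin (s + t)) R)
    (h : ∀ i j : Fin (s + t), (i : ℕ) < s → s ≤ (j : ℕ) → M i j = 0) :
    M.det = (M.submatrix (Fin.castAdd t) (Fin.castAdd t)).det *
      (M.submatrix (Fin.natAdd s) (Fin.natAdd s)).det := by
  rw [← Matrix.det_submatrix_equiv_self finSumFinEquiv M,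
    ← Matrix.fromBlocks_toBlocks (M.submatrix finSumFinEquiv finSumFinEquiv)]
  have h12 : (M.submatrix ⇑finSumFinEquiv ⇑finSumFinEquiv).toBlocks₁₂ = 0 := by
    ext i j
    simp only [Matrix.toBlocks₁₂, Matrix.of_apply, Matrix.submatrix_apply,
      finSumFinEquiv_apply_left, finSumFinEquiv_apply_right, Matrix.zero_apply]
    exact h _ _ i.2 (Nat.le_add_right s j)
  rw [h12, Matrix.det_fromBlocks_zero₁₂]
  rfl

/-- A square matrix over `Fin (s + t)` whose lower-left `t × s` block vanishes has determinant
`det (upper-left) · det (lower-right)`. [folklore] -/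
theorem det_eq_mul_of_lowerLeft_eq_zero {s t : ℕ} (M : Matrix (Fin (s + t)) (Fin (s + t)) R)
    (h : ∀ i j : Fin (s + t), s ≤ (i : ℕ) → (j : ℕ) < s → M i j = 0) :
    M.det = (M.submatrix (Fin.castAdd t) (Fin.castAdd t)).det *
      (M.submatrix (Fin.natAdd s) (Fin.natAdd s)).det := by
  rw [← Matrix.det_submatrix_equiv_self finSumFinEquiv M,
    ← Matrix.fromBlocks_toBlocks (M.submatrix finSumFinEquiv finSumFinEquiv)]
  have h21 : (M.submatrix ⇑finSumFinEquiv ⇑finSumFinEquiv).toBlocks₂₁ = 0 := by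
    ext i j
    simp only [Matrix.toBlocks₂₁, Matrix.of_apply, Matrix.submatrix_apply,
      finSumFinEquiv_apply_left, finSumFinEquiv_apply_right, Matrix.zero_apply]
    exact h _ _ (Nat.le_add_right s i) j.2
  rw [h21, Matrix.det_fromBlocks_zero₂₁]
  rfl

end Blocks

/-- Splitting a Toeplitz minor at a vanishing upper-right block. [folklore] -/
theorem toeplitzMinor_split_of_upperRight (a : ℕ → ℝ) {s t : ℕ} (r c : Fin (s + t) → ℕ)
    (h : ∀ i j : Fin (s + t), (i : ℕ) < s → s ≤ (j : ℕ) → seqZ a ((r i : ℤ) - c j) = 0) :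
    toeplitzMinor a r c = toeplitzMinor a (r ∘ Fin.castAdd t) (c ∘ Fin.castAdd t) *
      toeplitzMinor a (r ∘ Fin.natAdd s) (c ∘ Fin.natAdd s) := by
  unfold toeplitzMinor
  rw [det_eq_mul_of_upperRight_eq_zero _ fun i j hi hj => ?_]
  · rfl
  · simpa using h i j hi hj

/-- Splitting a Toeplitz minor at a vanishing lower-left block. [folklore] -/
theorem toeplitzMinor_split_of_lowerLeft (a : ℕ → ℝ) {s t : ℕ} (r c : Fin (s + t) → ℕ)
    (h : ∀ i j : Fin (s + t), s ≤ (i : ℕ) → (j : ℕ) < s → seqZ a ((r i : ℤ) - c j) = 0) :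
    toeplitzMinor a r c = toeplitzMinor a (r ∘ Fin.castAdd t) (c ∘ Fin.castAdd t) *
      toeplitzMinor a (r ∘ Fin.natAdd s) (c ∘ Fin.natAdd s) := by
  unfold toeplitzMinor
  rw [det_eq_mul_of_lowerLeft_eq_zero _ fun i j hi hj => ?_]
  · rfl
  · simpa using h i j hi hj

/-! ### Three-term sequences: continuants and the tridiagonal Toeplitz determinant -/

/-- The **continuant** of the tridiagonal Toeplitz matrix with diagonal `y`, super-diagonal `x`
and sub-diagonal `z`: `D₀ = 1`, `D₁ = y`, `D_{n+2} = y D_{n+1} - x z D_n`. [folklore] -/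
def continuant (x y z : ℝ) : ℕ → ℝ
  | 0 => 1
  | 1 => y
  | n + 2 => y * continuant x y z (n + 1) - x * z * continuant x y z n

/-- `D₀ = 1`. [folklore] -/
@[simp] theorem continuant_zero (x y z : ℝ) : continuant x y z 0 = 1 := rfl

/-- `D₁ = y`. [folklore] -/
@[simp] theorem continuant_one (x y z : ℝ) : continuant x y z 1 = y := rfl

/-- The three-term recursion `D_{n+2} = y D_{n+1} - x z D_n`. [folklore] -/
theorem continuant_add_two (x y z : ℝ) (n : ℕ) :
    continuant x y z (n + 2) = y * continuant x y z (n + 1) - x * z * continuant x y z n := rfl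

/-- The `n × n` tridiagonal Toeplitz matrix `(a_{i+1-j})_{i,j < n}` of a sequence `a`.
[folklore] -/
def triToeplitz (a : ℕ → ℝ) (n : ℕ) : Matrix (Fin n) (Fin n) ℝ :=
  Matrix.of fun i j : Fin n => seqZ a (((i : ℕ) : ℤ) + 1 - ((j : ℕ) : ℤ))

/-- Entries of `triToeplitz`. [folklore] -/
theorem triToeplitz_apply (a : ℕ → ℝ) (n : ℕ) (i j : Fin n) :
    triToeplitz a n i j = seqZ a (((i : ℕ) : ℤ) + 1 - ((j : ℕ) : ℤ)) := rfl

/-- `seqZ a 0 = a 0`. [folklore] -/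
@[simp] theorem seqZ_zero (a : ℕ → ℝ) : seqZ a 0 = a 0 := by
  simpa using seqZ_natCast a 0

/-- `seqZ a 1 = a 1`. [folklore] -/
@[simp] theorem seqZ_one (a : ℕ → ℝ) : seqZ a 1 = a 1 := by
  simpa using seqZ_natCast a 1

/-- `seqZ a 2 = a 2`. [folklore] -/
@[simp] theorem seqZ_two (a : ℕ → ℝ) : seqZ a 2 = a 2 := by
  simpa using seqZ_natCast a 2

/-- `seqZ a k = 0` for `k ≥ 3` when `a` is a three-term sequence. [folklore] -/
theorem seqZ_eq_zero_of_three_le {a : ℕ → ℝ} (h3 : ∀ n, 3 ≤ n → a n = 0) {k : ℤ} (hk : 3 ≤ k) :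
    seqZ a k = 0 := by
  obtain ⟨n, rfl⟩ := Int.eq_ofNat_of_zero_le (by omega : (0 : ℤ) ≤ k)
  rw [seqZ_natCast]
  exact h3 n (by exact_mod_cast hk)

/-- All extended terms of a non-negative three-term sequence are `≥ 0`. [folklore] -/
theorem seqZ_nonneg_of_three {a : ℕ → ℝ} (h3 : ∀ n, 3 ≤ n → a n = 0) (h0 : 0 ≤ a 0)
    (h1 : 0 ≤ a 1) (h2 : 0 ≤ a 2) (k : ℤ) : 0 ≤ seqZ a k := by
  unfold seqZ
  split_ifs with hk
  · rcases Nat.lt_or_ge k.toNat 3 with h | h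
    · interval_cases (k.toNat) <;> assumption
    · exact (h3 _ h).symm.le
  · exact le_rfl

/-- **The tridiagonal Toeplitz determinant is the continuant**:
`det (a_{i+1-j})_{i,j<n} = Dₙ(a₀, a₁, a₂)` for a three-term sequence `a`. (Laplace expansion
along the first row, then along the first column.) [folklore] -/
theorem det_triToeplitz {a : ℕ → ℝ} (h3 : ∀ n, 3 ≤ n → a n = 0) :
    ∀ n, (triToeplitz a n).det = continuant (a 0) (a 1) (a 2) n
  | 0 => by simp [Matrix.det_isEmpty]
  | 1 => by
    rw [Matrix.det_unique, continuant_one, triToeplitz_apply]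
    simp
  | n + 2 => by
    rw [Matrix.det_succ_row_zero, Fin.sum_univ_succ, Fin.sum_univ_succ,
      Finset.sum_eq_zero (fun (j : Fin n) _ => ?_), add_zero, continuant_add_two]
    · -- the two surviving terms
      have hA00 : triToeplitz a (n + 2) 0 0 = a 1 := by
        rw [triToeplitz_apply]; simp
      have hA01 : triToeplitz a (n + 2) 0 (Fin.succ 0) = a 0 := by
        rw [triToeplitz_apply]; simp
      have hM0 : (triToeplitz a (n + 2)).submatrix Fin.succ (Fin.succAbove 0) =
          triToeplitz a (n + 1) := by
        ext i j
        simp only [Matrix.submatrix_apply, Fin.succAbove_zero, triToeplitz_apply, Fin.val_succ]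
        congr 1
        push_cast
        ring
      -- the `(0,1)` cofactor, expanded along its first column
      have hM1 : ((triToeplitz a (n + 2)).submatrix Fin.succ (Fin.succAbove (Fin.succ 0))).det =
          a 2 * (triToeplitz a n).det := by
        rw [Matrix.det_succ_column_zero, Fin.sum_univ_succ,
          Finset.sum_eq_zero (fun (i : Fin n) _ => ?_), add_zero]
        · have hN00 : ((triToeplitz a (n + 2)).submatrix Fin.succ (Fin.succAbove (Fin.succ 0)))
              0 0 = a 2 := by
            simp only [Matrix.submatrix_apply, Fin.succ_zero_eq_one, Fin.one_succAbove_zero,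
              triToeplitz_apply, Fin.val_zero]
            simp
          have hN : ((triToeplitz a (n + 2)).submatrix Fin.succ
              (Fin.succAbove (Fin.succ 0))).submatrix (Fin.succAbove 0) Fin.succ =
              triToeplitz a n := by
            ext i j
            simp only [Matrix.submatrix_apply, Fin.succ_zero_eq_one, Fin.one_succAbove_succ,
              Fin.succAbove_zero, triToeplitz_apply, Fin.val_succ]
            congr 1
            push_cast
            ring
          rw [hN00, hN]
          simp
        · simp only [Matrix.submatrix_apply, Fin.succ_zero_eq_one, Fin.one_succAbove_zero,
            triToeplitz_apply, Fin.val_succ, Fin.val_zero]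
          rw [seqZ_eq_zero_of_three_le h3 (by push_cast; omega)]
          simp
      rw [hA00, hA01, hM0, hM1, det_triToeplitz h3 (n + 1), det_triToeplitz h3 n]
      simp
      ring
    · -- the remaining first-row entries vanish
      have : triToeplitz a (n + 2) 0 (j.succ.succ) = 0 := by
        rw [triToeplitz_apply]
        exact seqZ_of_neg _ (by simp; omega)
      rw [this]
      simp

/-! ### Schoenberg's lemma: three-term sequences with non-negative continuants are `PF_m` -/

/-- In a Toeplitz minor of a three-term sequence with no vanishing off-diagonal block, the row
and column indices are consecutive with `rᵢ = cᵢ + 1`. [Schoenberg 1955] [folklore] -/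
theorem rigid_of_no_cut {k : ℕ} {r c : Fin (k + 2) → ℕ} (hr : StrictMono r) (hc : StrictMono c)
    (hcut : ∀ i j : Fin (k + 2), (j : ℕ) = i + 1 → c j ≤ r i ∧ r j ≤ c i + 2) (i : Fin (k + 2)) :
    r i = c i + 1 ∧ c i = c 0 + i := by
  induction i using Fin.induction with
  | zero =>
    refine ⟨?_, by simp⟩
    have h := hcut 0 1 (by simp)
    have h1 : c 0 < c 1 := hc (by simp)
    have h2 : r 0 < r 1 := hr (by simp)
    omega
  | succ i ih =>
    have h := hcut i.castSucc i.succ (by simp)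
    have h1 : c i.castSucc < c i.succ := hc (Fin.castSucc_lt_succ (i := i))
    have h2 : r i.castSucc < r i.succ := hr (Fin.castSucc_lt_succ (i := i))
    obtain ⟨ih1, ih2⟩ := ih
    simp only [Fin.val_succ, Fin.val_castSucc] at ih1 ih2 h ⊢
    constructor
    · omega
    · omega

/-- **Schoenberg's lemma on three-term sequences.** If `a = (a₀, a₁, a₂, 0, 0, …)` has
`a₀, a₁, a₂ ≥ 0` and its continuants `Dₙ(a₀, a₁, a₂)` (`= det (a_{i+1-j})_{i,j<n}`) are `≥ 0`
for `n ≤ m`, then `a` is `m`-times positive. Proof: a Toeplitz minor of a three-term sequence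
either splits as a product of two smaller such minors at a vanishing off-diagonal block, or is
rigid (consecutive indices, `rᵢ = cᵢ + 1`), i.e. a continuant. This is the computation behind
"`(1, 2cos φ, 1) ∈ PF_m ⟺ φ ≤ π/(m+1)`". [Schoenberg 1955; Katkova 2006, §1 (Thm. B)]
[folklore] -/
theorem isMultiplyPositiveSeq_of_continuant_nonneg {m : ℕ} {a : ℕ → ℝ}
    (h3 : ∀ n, 3 ≤ n → a n = 0) (h0 : 0 ≤ a 0) (h1 : 0 ≤ a 1) (h2 : 0 ≤ a 2)
    (hD : ∀ n, n ≤ m → 0 ≤ continuant (a 0) (a 1) (a 2) n) : IsMultiplyPositiveSeq m a := by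
  suffices H : ∀ k, k ≤ m → ∀ (r c : Fin k → ℕ), StrictMono r → StrictMono c →
      0 ≤ toeplitzMinor a r c from fun k hk r c hr hc => H k hk r c hr hc
  intro k
  induction k using Nat.strong_induction_on with
  | _ k ih =>
  intro hk r c hr hc
  by_cases hcut : ∃ i j : Fin k, (j : ℕ) = i + 1 ∧ (r i < c j ∨ c i + 2 < r j)
  · -- split at a vanishing block
    obtain ⟨i, j, hij, hcase⟩ := hcut
    obtain ⟨s, hs⟩ : ∃ s : ℕ, (j : ℕ) = s := ⟨_, rfl⟩
    have hsk : s < k := hs ▸ j.2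
    obtain ⟨t, rfl⟩ : ∃ t, k = s + t := ⟨k - s, by omega⟩
    have hs0 : 0 < s := by omega
    have ht0 : 0 < t := by omega
    have hmono₁ : StrictMono (Fin.castAdd t : Fin s → Fin (s + t)) := fun a b h => h
    have hmono₂ : StrictMono (Fin.natAdd s : Fin t → Fin (s + t)) := fun a b h => by
      change s + (a : ℕ) < s + (b : ℕ)
      exact Nat.add_lt_add_left h s
    have key : toeplitzMinor a r c = toeplitzMinor a (r ∘ Fin.castAdd t) (c ∘ Fin.castAdd t) *
        toeplitzMinor a (r ∘ Fin.natAdd s) (c ∘ Fin.natAdd s) := by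
      rcases hcase with hU | hL
      · refine toeplitzMinor_split_of_upperRight a r c fun i' j' hi' hj' => seqZ_of_neg _ ?_
        have h1 : r i' ≤ r i := hr.monotone (by
          change (i' : ℕ) ≤ i
          omega)
        have h2 : c j ≤ c j' := hc.monotone (by
          change (j : ℕ) ≤ j'
          omega)
        omega
      · refine toeplitzMinor_split_of_lowerLeft a r c fun i' j' hi' hj' =>
          seqZ_eq_zero_of_three_le h3 ?_
        have h1 : r j ≤ r i' := hr.monotone (by
          change (j : ℕ) ≤ i'
          omega)
        have h2 : c j' ≤ c i := hc.monotone (by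
          change (j' : ℕ) ≤ i
          omega)
        omega
    rw [key]
    exact mul_nonneg (ih s (by omega) (by omega) _ _ (hr.comp hmono₁) (hc.comp hmono₁))
      (ih t (by omega) (by omega) _ _ (hr.comp hmono₂) (hc.comp hmono₂))
  · -- no cut: the minor is rigid
    push Not at hcut
    have hcut' : ∀ i j : Fin k, (j : ℕ) = i + 1 → c j ≤ r i ∧ r j ≤ c i + 2 := fun i j hij =>
      hcut i j hij
    match k, r, c, hr, hc, hcut', hk with
    | 0, r, c, _, _, _, _ => simp [toeplitzMinor, Matrix.det_isEmpty]
    | 1, r, c, _, _, _, _ =>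
      rw [toeplitzMinor, Matrix.det_unique]
      exact seqZ_nonneg_of_three h3 h0 h1 h2 _
    | k + 2, r, c, hr, hc, hcut', hk =>
      have hrig := rigid_of_no_cut hr hc hcut'
      have hmat : (Matrix.of fun i j : Fin (k + 2) => seqZ a ((r i : ℤ) - c j)) =
          triToeplitz a (k + 2) := by
        ext i j
        rw [Matrix.of_apply, triToeplitz_apply, (hrig i).1, (hrig i).2, (hrig j).2]
        congr 1
        push_cast
        ring
      rw [toeplitzMinor, hmat, det_triToeplitz h3]
      exact hD _ hk


/-! ### The two kinds of real irreducible factors -/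

/-- Continuants of `X + t`: all equal to `1`. [folklore] -/
theorem continuant_linear (t : ℝ) : ∀ n, continuant t 1 0 n = 1
  | 0 => rfl
  | 1 => rfl
  | n + 2 => by rw [continuant_add_two, continuant_linear t (n + 1)]; ring

open Polynomial.Chebyshev in
/-- Continuants of `X² + 2ρx·X + ρ²` are `ρⁿ Uₙ(x)` (Chebyshev polynomials of the second kind:
the same three-term recurrence). [Schoenberg 1955; Katkova 2006, §1] [folklore] -/
theorem continuant_quadratic (ρ x : ℝ) :
    ∀ n : ℕ, continuant (ρ ^ 2) (2 * ρ * x) 1 n = ρ ^ n * (U ℝ n).eval x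
  | 0 => by simp
  | 1 => by simp [U_one]; ring
  | n + 2 => by
    rw [continuant_add_two, continuant_quadratic ρ x (n + 1), continuant_quadratic ρ x n]
    have h : U ℝ ((n + 2 : ℕ) : ℤ) = 2 * X * U ℝ ((n + 1 : ℕ) : ℤ) - U ℝ (n : ℤ) := by
      have h := U_add_two ℝ (n : ℤ)
      push_cast at h ⊢
      exact h
    rw [h, eval_sub, eval_mul, eval_mul, eval_X]
    simp
    ring

open Polynomial.Chebyshev in
/-- `Uₙ(cos φ) = sin((n+1)φ)/sin φ ≥ 0` when `0 < φ < π` and `(n+1)φ ≤ π`. [folklore] -/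
theorem U_eval_cos_nonneg {φ : ℝ} (hφ0 : 0 < φ) (hφπ : φ < Real.pi) {n : ℕ}
    (hn : ((n : ℝ) + 1) * φ ≤ Real.pi) : 0 ≤ (U ℝ n).eval (Real.cos φ) := by
  have hsin : 0 < Real.sin φ := Real.sin_pos_of_pos_of_lt_pi hφ0 hφπ
  have h := U_real_cos φ n
  push_cast at h
  have hs : 0 ≤ Real.sin (((n : ℝ) + 1) * φ) :=
    Real.sin_nonneg_of_nonneg_of_le_pi (by positivity) hn
  by_contra hneg
  push Not at hneg
  have := mul_neg_of_neg_of_pos hneg hsin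
  linarith

/-- Coefficients of `X + C t`. [folklore] -/
theorem coeff_X_add_C_eq (t : ℝ) (n : ℕ) :
    (X + Polynomial.C t).coeff n = if n = 0 then t else if n = 1 then 1 else 0 := by
  rcases n with _ | _ | n
  · simp
  · simp
  · simp [coeff_X]

/-- Coefficients of `X² + C b X + C c`. [folklore] -/
theorem coeff_quadratic_eq (b c : ℝ) (n : ℕ) :
    (X ^ 2 + Polynomial.C b * X + Polynomial.C c).coeff n =
      if n = 0 then c else if n = 1 then b else if n = 2 then 1 else 0 := by
  rcases n with _ | _ | _ | n
  · simp
  · simp [coeff_X_pow]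
  · simp [coeff_X_pow]
  · simp [coeff_X_pow]

/-- **`X + t` (`t ≥ 0`) has a `PF_m` coefficient sequence** for every `m` (indeed PF).
[Schoenberg 1955; Katkova 2006, §1] [folklore] -/
theorem isMultiplyPositiveSeq_coeff_X_add_C (m : ℕ) {t : ℝ} (ht : 0 ≤ t) :
    IsMultiplyPositiveSeq m fun n => (X + Polynomial.C t).coeff n := by
  simp only [coeff_X_add_C_eq]
  refine isMultiplyPositiveSeq_of_continuant_nonneg (fun n hn => ?_) ?_ ?_ ?_ (fun n _ => ?_)
  · have h0 : n ≠ 0 := by omega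
    have h1 : n ≠ 1 := by omega
    simp [h0, h1]
  · simpa using ht
  · simp
  · simp
  · simp only [if_true, one_ne_zero, if_false, show (2 : ℕ) ≠ 0 from two_ne_zero,
      show (2 : ℕ) ≠ 1 from by decide, continuant_linear]
    norm_num

/-- **Schoenberg's quadratic lemma**: `X² + 2ρ cos φ · X + ρ²` (`ρ ≥ 0`, `0 < φ < π`) has an
`m`-times positive coefficient sequence as soon as `(m+1)φ ≤ π`; its continuants are
`ρⁿ sin((n+1)φ)/sin φ ≥ 0` for `n ≤ m`. [Schoenberg 1955; Katkova 2006, §1 (Thm. B)]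
[folklore] -/
theorem isMultiplyPositiveSeq_coeff_quadratic (m : ℕ) {ρ φ : ℝ} (hρ : 0 ≤ ρ) (hφ0 : 0 < φ)
    (hφπ : φ < Real.pi) (hφm : ((m : ℝ) + 1) * φ ≤ Real.pi) :
    IsMultiplyPositiveSeq m fun n =>
      (X ^ 2 + Polynomial.C (2 * ρ * Real.cos φ) * X + Polynomial.C (ρ ^ 2)).coeff n := by
  rcases Nat.eq_zero_or_pos m with rfl | hm
  · exact isMultiplyPositiveSeq_zero _
  have hcos : 0 ≤ Real.cos φ := by
    refine Real.cos_nonneg_of_neg_pi_div_two_le_of_le (by linarith [Real.pi_pos]) ?_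
    have hm1 : (1 : ℝ) ≤ m := by exact_mod_cast hm
    nlinarith [Real.pi_pos]
  simp only [coeff_quadratic_eq]
  refine isMultiplyPositiveSeq_of_continuant_nonneg (fun n hn => ?_) ?_ ?_ ?_ (fun n hn => ?_)
  · have h0 : n ≠ 0 := by omega
    have h1 : n ≠ 1 := by omega
    have h2 : n ≠ 2 := by omega
    simp [h0, h1, h2]
  · simpa using sq_nonneg ρ
  · simpa using mul_nonneg (mul_nonneg zero_le_two hρ) hcos
  · simp
  · simp only [if_true, one_ne_zero, if_false, show (2 : ℕ) ≠ 0 from two_ne_zero,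
      show (2 : ℕ) ≠ 1 from by decide, continuant_quadratic]
    refine mul_nonneg (pow_nonneg hρ n) (U_eval_cos_nonneg hφ0 hφπ ?_)
    have hnm : (n : ℝ) + 1 ≤ (m : ℝ) + 1 := by exact_mod_cast Nat.succ_le_succ hn
    nlinarith

/-! ### Schoenberg's sector theorem -/

/-- The induction on the degree behind Theorem B (for `m ≥ 1`): split off a real root (which is
negative, as the positive axis lies in the zero-free sector and `f(0) > 0`) or a pair of conjugate
roots `w, w̄` with `|arg w| ≥ πm/(m+1)`, i.e. a factor `X² + 2ρ cos φ X + ρ²` with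
`0 < φ = π - |arg w| ≤ π/(m+1)`; both factors are `PF_m`, and `PF_m` is closed under products
(Cauchy–Binet). [Katkova 2006, §1 Thm. B; Schoenberg 1955] [folklore] -/
theorem schoenberg_sector_pf_aux {m : ℕ} (hm : 1 ≤ m) :
    ∀ (N : ℕ) (f : ℝ[X]), f.natDegree ≤ N → 0 < f.coeff 0 →
      (∀ z : ℂ, |z.arg| < Real.pi * m / (m + 1) → Polynomial.aeval z f ≠ 0) →
        IsMultiplyPositiveSeq m fun n => f.coeff n := by
  have hsector_pos : 0 < Real.pi * m / (m + 1) := by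
    have : (0 : ℝ) < m := by exact_mod_cast hm
    positivity
  intro N
  induction N with
  | zero =>
    intro f hdeg h0 _
    have hf : f = Polynomial.C (f.coeff 0) := eq_C_of_natDegree_eq_zero (Nat.le_zero.1 hdeg)
    have : (fun n => f.coeff n) = fun n => f.coeff 0 * (if n = 0 then (1 : ℝ) else 0) := by
      funext n
      conv_lhs => rw [hf]
      rw [coeff_C]
      split_ifs <;> simp
    rw [this]
    exact (isMultiplyPositiveSeq_delta m).smul h0.le
  | succ N ih =>
    intro f hdeg h0 hz
    by_cases hdeg' : f.natDegree ≤ N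
    · exact ih f hdeg' h0 hz
    have hdegf : f.natDegree = N + 1 := by omega
    have hf0 : f ≠ 0 := by
      rintro rfl
      simp at h0
    -- a complex root `w`
    obtain ⟨w, hw⟩ : ∃ w : ℂ, Polynomial.aeval w f = 0 :=
      IsAlgClosed.exists_aeval_eq_zero ℂ f (by
        rw [degree_eq_natDegree hf0, hdegf]
        exact_mod_cast Nat.succ_ne_zero N)
    -- zeros of a factor are zeros of `f`
    have hzero_of_dvd : ∀ g : ℝ[X], g ∣ f →
        ∀ z : ℂ, |z.arg| < Real.pi * m / (m + 1) → Polynomial.aeval z g ≠ 0 := by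
      rintro g ⟨q, rfl⟩ z hzarg hg
      exact hz z hzarg (by rw [map_mul, hg, zero_mul])
    by_cases him : w.im = 0
    · -- a real root `x < 0`
      set x : ℝ := w.re with hx
      have hwx : w = (x : ℂ) := Complex.ext (by simp [hx]) (by simp [him])
      have hroot : f.IsRoot x := by
        have h := Polynomial.aeval_algebraMap_apply_eq_algebraMap_eval (A := ℂ) x f
        rw [Polynomial.IsRoot.def]
        rw [Complex.coe_algebraMap, ← hwx, hw] at h
        exact_mod_cast h.symm
      have hx0 : x ≠ 0 := by
        rintro h0'
        rw [Polynomial.IsRoot.def, h0', ← Polynomial.coeff_zero_eq_eval_zero] at hroot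
        exact h0.ne' hroot
      have hxneg : x < 0 := by
        rcases lt_or_gt_of_ne hx0 with h | h
        · exact h
        · exfalso
          refine hz w ?_ hw
          rw [hwx, Complex.arg_ofReal_of_nonneg h.le, abs_zero]
          exact hsector_pos
      -- `f = (X + C t) * g`, `t = -x > 0`
      set g : ℝ[X] := f /ₘ (X - Polynomial.C x) with hg
      have hfg : f = (X + Polynomial.C (-x)) * g := by
        rw [Polynomial.C_neg, ← sub_eq_add_neg, hg]
        exact (Polynomial.mul_divByMonic_eq_iff_isRoot.2 hroot).symm
      have hgdeg : g.natDegree ≤ N := by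
        rw [hg, Polynomial.natDegree_divByMonic f (Polynomial.monic_X_sub_C x),
          Polynomial.natDegree_X_sub_C]
        omega
      have hg0 : 0 < g.coeff 0 := by
        have h := h0
        rw [hfg, Polynomial.mul_coeff_zero] at h
        simp only [coeff_add, coeff_X_zero, coeff_C_zero, zero_add] at h
        exact (mul_pos_iff_of_pos_left (by linarith)).1 h
      have hgz := hzero_of_dvd g ⟨X + Polynomial.C (-x), by rw [hfg]; ring⟩
      rw [hfg]
      exact (isMultiplyPositiveSeq_coeff_X_add_C m (by linarith)).mul_poly (ih g hgdeg hg0 hgz)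
    · -- a pair of conjugate roots: the quadratic factor
      have hqdvd := Polynomial.quadratic_dvd_of_aeval_eq_zero_im_ne_zero f hw him
      obtain ⟨g, hfg⟩ := hqdvd
      have hw0 : w ≠ 0 := by
        rintro rfl
        exact him rfl
      have hρ : 0 < ‖w‖ := norm_pos_iff.2 hw0
      -- the angle `φ = π - |arg w| ∈ (0, π/(m+1)]`
      have harg : Real.pi * m / (m + 1) ≤ |w.arg| := not_lt.1 fun h => hz w h hw
      have harg_lt : |w.arg| < Real.pi := by
        refine lt_of_le_of_ne (Complex.abs_arg_le_pi w) fun h => ?_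
        have : w.arg = Real.pi := by
          rcases abs_eq (Real.pi_pos.le) |>.1 h with h' | h'
          · exact h'
          · linarith [Complex.neg_pi_lt_arg w]
        exact him (Complex.arg_eq_pi_iff.1 this).2
      have harg_pos : 0 < |w.arg| := by
        refine abs_pos.2 fun h => ?_
        exact him (Complex.arg_eq_zero_iff.1 h).2
      set φ : ℝ := Real.pi - |w.arg| with hφ
      have hφ0 : 0 < φ := by rw [hφ]; linarith
      have hφπ : φ < Real.pi := by rw [hφ]; linarith
      have hφm : ((m : ℝ) + 1) * φ ≤ Real.pi := by
        rw [hφ]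
        have hm0 : (0 : ℝ) < (m : ℝ) + 1 := by positivity
        rw [div_le_iff₀ hm0] at harg
        nlinarith
      have hcosφ : 2 * ‖w‖ * Real.cos φ = -(2 * w.re) := by
        rw [hφ, Real.cos_pi_sub, Real.cos_abs, Complex.cos_arg hw0]
        field_simp
      have hq : (X ^ 2 - Polynomial.C (2 * w.re) * X + Polynomial.C (‖w‖ ^ 2) : ℝ[X]) =
          X ^ 2 + Polynomial.C (2 * ‖w‖ * Real.cos φ) * X + Polynomial.C (‖w‖ ^ 2) := by
        rw [hcosφ, Polynomial.C_neg]
        ring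
      rw [hq] at hfg
      set q : ℝ[X] := X ^ 2 + Polynomial.C (2 * ‖w‖ * Real.cos φ) * X + Polynomial.C (‖w‖ ^ 2)
        with hqdef
      have hq2 : q.coeff 2 = 1 := by
        rw [hqdef, coeff_quadratic_eq]
        simp
      have hq0 : q.coeff 0 = ‖w‖ ^ 2 := by
        rw [hqdef, coeff_quadratic_eq]
        simp
      have hqne : q ≠ 0 := fun h => by
        rw [h, coeff_zero] at hq2
        exact zero_ne_one hq2
      have hgne : g ≠ 0 := fun h => by
        rw [h, mul_zero] at hfg
        exact hf0 hfg
      have hgdeg : g.natDegree ≤ N := by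
        have h1 : f.natDegree = q.natDegree + g.natDegree := by
          rw [hfg, Polynomial.natDegree_mul hqne hgne]
        have h2 : 2 ≤ q.natDegree := Polynomial.le_natDegree_of_ne_zero (by rw [hq2]; exact one_ne_zero)
        omega
      have hg0 : 0 < g.coeff 0 := by
        have h := h0
        rw [hfg, Polynomial.mul_coeff_zero, hq0] at h
        exact (mul_pos_iff_of_pos_left (by positivity)).1 h
      have hgz := hzero_of_dvd g (Dvd.intro_left q hfg.symm)
      rw [hfg]
      exact (isMultiplyPositiveSeq_coeff_quadratic m hρ.le hφ0 hφπ hφm).mul_poly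
        (ih g hgdeg hg0 hgz)

/-- **Schoenberg's sector theorem (Katkova's Theorem B), proved**: a real polynomial `f` with
`f(0) > 0` and no zeros in the open sector `|arg z| < πm/(m+1)` has an `m`-times positive
coefficient sequence. Discharges the named fact `schoenberg_sector_pf` of
`MultiplyPositive.lean`. [Schoenberg 1955; Katkova 2006, §1 Thm. B] [cite: Katkova2006, §1 Thm. B] -/
theorem schoenberg_sector_pf_holds : schoenberg_sector_pf := by
  intro m f h0 hz
  rcases Nat.eq_zero_or_pos m with rfl | hm
  · exact isMultiplyPositiveSeq_zero _
  · exact schoenberg_sector_pf_aux hm f.natDegree f le_rfl h0 hz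

end Literature.Analysis.TotalPositivity
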